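import Summits.AnomalousDissipation.AnomalousDissipation.Theorems.QuarticGate.Negative.LevelCeiling

/-!
# Negative knowledge for the crux `MomentParity.UniformResolution` (stmt-AnomalousDissipation-14330), IV:
# a RESOLUTION CRITERION (where the crux exactly lives)

Certified copy of section H of the cdisprove work file `Cruxes/UniformResolution/Disproof.lean`
(refuter-cdisprove-stmt-AnomalousDissipation-14330-0, cycle 1). Supports stmt-AnomalousDissipation-14330; no
route-item statement is asserted. A positive-side tool recording the disprover's reduction of the crux: its
conclusion (one resolution schedule `κ`, uniform over a family of level-`N` laws) follows from two N-uniform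
estimates on the family — UNIFORM INTEGRABILITY of the enstrophy `‖∇u‖²` (the open part: only its mean is known
N-uniformly for 3-D stationary statistical solutions, FMRT 2001 Ch. IV (1.31)–(1.33)) and a uniform WEIGHTED
`H²` BOUND `∫ |Au|²/(1+‖∇u‖²)² dμ ≤ C` (the Foias–Guillopé–Temam shape, N-uniform for Galerkin-invariant laws
by Agmon's inequality). So a refutation of the crux must force intermittent (non-uniformly-integrable)
enstrophy on EVERY loud invariant family of some force at some fixed viscosity.

* `eLapNormSq v = 16π⁴ Σ |k|⁴ ‖v̂ k‖²` (spectral `|Av|²`); `tailGradNormSq_mul_le_eLapNormSq`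
  (spectral Chebyshev `4π²(m²+1) · tailGradNormSq m v ≤ |Av|²`); `eGradNormSq_eq_fourierTruncate_add_tail`
  (`‖∇v‖² = ‖∇P_m v‖² + tail_m`); Borel measurability of `|Au|²` and of the tail on `H`.
* `UniformlyIntegrableEnstrophy`, `WeightedH2Bound` (hypotheses on a family of laws, named);
  `exists_isResolved_of_uniformlyIntegrable_of_weightedH2` — the criterion, with the resolution clause of the
  crux written verbatim.
-/

namespace Summit.AnomalousDissipation.AnomalousDissipation.Theorems.UniformResolution.Negative

open MeasureTheory Filter Topology
open scoped ENNReal InnerProductSpace RealInnerProductSpace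
open Literature.Analysis.FunctionSpaces Literature.Analysis.FluidPDE
open Summit.AnomalousDissipation.AnomalousDissipation.Theses.MomentParity
open Summit.AnomalousDissipation.AnomalousDissipation.Theorems.QuarticGate.Negative

noncomputable section

/-- Local notation for the real Hilbert space `L²(T³; ℝ³)`. -/
local notation "L2T3" => Lp (EuclideanSpace ℝ (Fin 3)) 2 (volume : Measure (UnitAddTorus (Fin 3)))

/-! ## H. A RESOLUTION CRITERION: uniform integrability of the enstrophy + a weighted `H²` bound -/

section Criterion

/-- The spectral `‖Δv‖²_{L²} = |Av|² = 16π⁴ Σₖ |k|⁴ ‖v̂(k)‖²` of a field on `T³` (in `ℝ≥0∞`). -/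
def eLapNormSq (v : UnitAddTorus (Fin 3) → EuclideanSpace ℝ (Fin 3)) : ℝ≥0∞ :=
  ENNReal.ofReal (16 * Real.pi ^ 4) *
    ∑' k : Fin 3 → ℤ, ENNReal.ofReal (Torus.freqNormSq k) ^ 2 *
      ‖UnitAddTorus.mFourierCoeff (EuclideanSpace.complexify ∘ v) k‖ₑ ^ 2

/-- **Spectral Chebyshev for the enstrophy tail**: `4π²(m²+1) · tailGradNormSq m v ≤ ‖Δv‖²`
(`|k|² ≥ m² + 1` off the ball). [folklore] -/
theorem tailGradNormSq_mul_le_eLapNormSq (m : ℕ) (v : UnitAddTorus (Fin 3) → EuclideanSpace ℝ (Fin 3)) :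
    Torus.tailGradNormSq m v * ENNReal.ofReal (4 * Real.pi ^ 2 * ((m : ℝ) ^ 2 + 1)) ≤ eLapNormSq v := by
  rw [Torus.tailGradNormSq, eLapNormSq, mul_comm, ← mul_assoc, ← ENNReal.ofReal_mul (by positivity),
    ← ENNReal.tsum_mul_left, ← ENNReal.tsum_mul_left]
  calc ∑' k : {k : Fin 3 → ℤ // k ∉ Torus.freqBall m},
        ENNReal.ofReal (4 * Real.pi ^ 2 * ((m : ℝ) ^ 2 + 1) * (4 * Real.pi ^ 2)) *
          (ENNReal.ofReal (Torus.freqNormSq (k : Fin 3 → ℤ)) *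
            ‖UnitAddTorus.mFourierCoeff (EuclideanSpace.complexify ∘ v) (k : Fin 3 → ℤ)‖ₑ ^ 2)
      ≤ ∑' k : {k : Fin 3 → ℤ // k ∉ Torus.freqBall m},
        ENNReal.ofReal (16 * Real.pi ^ 4) *
          (ENNReal.ofReal (Torus.freqNormSq (k : Fin 3 → ℤ)) ^ 2 *
            ‖UnitAddTorus.mFourierCoeff (EuclideanSpace.complexify ∘ v) (k : Fin 3 → ℤ)‖ₑ ^ 2) := by
        refine ENNReal.tsum_le_tsum fun k => ?_
        have hk := Torus.sq_add_one_le_freqNormSq_of_not_mem k.2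
        have h0 : 0 ≤ Torus.freqNormSq (k : Fin 3 → ℤ) := Torus.freqNormSq_nonneg _
        set q : ℝ := Torus.freqNormSq (k : Fin 3 → ℤ) with hq
        set Z : ℝ≥0∞ := ‖UnitAddTorus.mFourierCoeff (EuclideanSpace.complexify ∘ v) (k : Fin 3 → ℤ)‖ₑ ^ 2
        have key : ENNReal.ofReal (4 * Real.pi ^ 2 * ((m : ℝ) ^ 2 + 1) * (4 * Real.pi ^ 2)) * ENNReal.ofReal q ≤
            ENNReal.ofReal (16 * Real.pi ^ 4) * (ENNReal.ofReal q * ENNReal.ofReal q) := by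
          rw [← ENNReal.ofReal_mul (by positivity), ← ENNReal.ofReal_mul h0,
            ← ENNReal.ofReal_mul (by positivity)]
          apply ENNReal.ofReal_le_ofReal
          have h1 : ((m : ℝ) ^ 2 + 1) * q ≤ q * q := by nlinarith
          have h2 : 4 * Real.pi ^ 2 * ((m : ℝ) ^ 2 + 1) * (4 * Real.pi ^ 2) * q =
              16 * Real.pi ^ 4 * (((m : ℝ) ^ 2 + 1) * q) := by ring
          rw [h2]
          exact mul_le_mul_of_nonneg_left h1 (by positivity)
        calc ENNReal.ofReal (4 * Real.pi ^ 2 * ((m : ℝ) ^ 2 + 1) * (4 * Real.pi ^ 2)) * (ENNReal.ofReal q * Z)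
            = (ENNReal.ofReal (4 * Real.pi ^ 2 * ((m : ℝ) ^ 2 + 1) * (4 * Real.pi ^ 2)) * ENNReal.ofReal q) * Z := by
              ring
          _ ≤ (ENNReal.ofReal (16 * Real.pi ^ 4) * (ENNReal.ofReal q * ENNReal.ofReal q)) * Z := by gcongr
          _ = ENNReal.ofReal (16 * Real.pi ^ 4) * (ENNReal.ofReal q ^ 2 * Z) := by rw [sq]; ring
    _ ≤ ∑' k : Fin 3 → ℤ, ENNReal.ofReal (16 * Real.pi ^ 4) *
          (ENNReal.ofReal (Torus.freqNormSq k) ^ 2 *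
            ‖UnitAddTorus.mFourierCoeff (EuclideanSpace.complexify ∘ v) k‖ₑ ^ 2) :=
        ENNReal.tsum_comp_le_tsum_of_injective Subtype.val_injective
          (fun k => ENNReal.ofReal (16 * Real.pi ^ 4) *
            (ENNReal.ofReal (Torus.freqNormSq k) ^ 2 *
              ‖UnitAddTorus.mFourierCoeff (EuclideanSpace.complexify ∘ v) k‖ₑ ^ 2))

/-- **Splitting of the enstrophy at level `m`**: `‖∇v‖² = ‖∇P_m v‖² + tailGradNormSq m v` for
integrable `v`. [folklore] -/
theorem eGradNormSq_eq_fourierTruncate_add_tail {v : UnitAddTorus (Fin 3) → EuclideanSpace ℝ (Fin 3)}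
    (hv : Integrable v volume) (m : ℕ) :
    Torus.eGradNormSq v = Torus.eGradNormSq (Torus.fourierTruncate m v) + Torus.tailGradNormSq m v := by
  rw [Torus.eGradNormSq_eq_tsum, Torus.eGradNormSq_eq_tsum, Torus.tailGradNormSq, ← mul_add]
  congr 1
  set F : (Fin 3 → ℤ) → ℝ≥0∞ := fun k => ENNReal.ofReal (Torus.freqNormSq k) *
    ‖UnitAddTorus.mFourierCoeff (EuclideanSpace.complexify ∘ v) k‖ₑ ^ 2 with hF
  have h1 : ∑' k : Fin 3 → ℤ, ENNReal.ofReal (Torus.freqNormSq k) *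
      ‖UnitAddTorus.mFourierCoeff (EuclideanSpace.complexify ∘ Torus.fourierTruncate m v) k‖ₑ ^ 2 =
      ∑ k ∈ Torus.freqBall m, F k := by
    rw [tsum_eq_sum (s := Torus.freqBall m) (fun k hk => by
      rw [Torus.mFourierCoeff_fourierTruncate hv, if_neg hk]; simp)]
    exact Finset.sum_congr rfl fun k hk => by rw [Torus.mFourierCoeff_fourierTruncate hv, if_pos hk]
  have h2 : ∑' k : {k : Fin 3 → ℤ // k ∉ Torus.freqBall m}, ENNReal.ofReal (Torus.freqNormSq (k : Fin 3 → ℤ)) *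
      ‖UnitAddTorus.mFourierCoeff (EuclideanSpace.complexify ∘ v) (k : Fin 3 → ℤ)‖ₑ ^ 2 =
      ∑' k : {k : Fin 3 → ℤ // k ∉ Torus.freqBall m}, F k := rfl
  have h3 : ∑' k : Fin 3 → ℤ, ENNReal.ofReal (Torus.freqNormSq k) *
      ‖UnitAddTorus.mFourierCoeff (EuclideanSpace.complexify ∘ v) k‖ₑ ^ 2 = ∑' k, F k := rfl
  rw [h1, h2, h3]
  exact (ENNReal.sum_add_tsum_compl (Torus.freqBall m) F).symm

/-- The map `u ↦ ‖Δu‖²` (spectral) is Borel measurable on `H`. [folklore] -/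
theorem measurable_eLapNormSq_coe :
    Measurable fun u : Torus.energySpace (Fin 3) =>
      eLapNormSq ((u.1 : L2T3) : UnitAddTorus (Fin 3) → EuclideanSpace ℝ (Fin 3)) := by
  unfold eLapNormSq
  refine Measurable.const_mul (Measurable.tsum fun k => Measurable.const_mul ?_ _) _
  exact ((Torus.continuous_mFourierCoeff_complexify_coe k).comp
    continuous_subtype_val).measurable.enorm.pow_const 2

/-- The map `u ↦ tailGradNormSq m u` is Borel measurable on `H`. [folklore] -/
theorem measurable_tailGradNormSq_coe (m : ℕ) :
    Measurable fun u : Torus.energySpace (Fin 3) =>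
      Torus.tailGradNormSq m ((u.1 : L2T3) : UnitAddTorus (Fin 3) → EuclideanSpace ℝ (Fin 3)) := by
  unfold Torus.tailGradNormSq
  refine Measurable.const_mul (Measurable.tsum fun k => Measurable.const_mul ?_ _) _
  exact ((Torus.continuous_mFourierCoeff_complexify_coe (k : Fin 3 → ℤ)).comp
    continuous_subtype_val).measurable.enorm.pow_const 2

/-- UNIFORM INTEGRABILITY OF THE ENSTROPHY over a family of laws on `H`: the mean enstrophy carried by the
event `{‖∇u‖² > L}` is small uniformly over the family for large `L`. -/
def UniformlyIntegrableEnstrophy (𝓕 : Set (Measure (Torus.energySpace (Fin 3)))) : Prop :=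
  ∀ η : ℝ≥0∞, 0 < η → ∃ L : ℝ≥0∞, L ≠ ⊤ ∧ ∀ μ ∈ 𝓕,
    ∫⁻ u in {u : Torus.energySpace (Fin 3) |
        L < Torus.eGradNormSq ((u.1 : L2T3) : UnitAddTorus (Fin 3) → EuclideanSpace ℝ (Fin 3))},
      Torus.eGradNormSq ((u.1 : L2T3) : UnitAddTorus (Fin 3) → EuclideanSpace ℝ (Fin 3)) ∂μ ≤ η

/-- UNIFORM WEIGHTED `H²` BOUND (weight exponent `p`) over a family of laws on `H` (the Foias–Guillopé–Temam
shape `∫ |Au|²/(1+‖∇u‖²)^p dμ ≤ C`; `p = 2` classically, larger `p` for cruder interpolation inequalities). -/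
def WeightedH2Bound (p : ℕ) (𝓕 : Set (Measure (Torus.energySpace (Fin 3)))) : Prop :=
  ∃ C : ℝ≥0∞, C ≠ ⊤ ∧ ∀ μ ∈ 𝓕,
    ∫⁻ u, eLapNormSq ((u.1 : L2T3) : UnitAddTorus (Fin 3) → EuclideanSpace ℝ (Fin 3)) /
      (1 + Torus.eGradNormSq ((u.1 : L2T3) : UnitAddTorus (Fin 3) → EuclideanSpace ℝ (Fin 3))) ^ p ∂μ ≤ C

/-- **RESOLUTION CRITERION.** A family of laws on `H` with uniformly integrable enstrophy and a uniform
weighted `H²` bound is resolved by ONE schedule `κ`: for each `n`, split `∫ tailGradNormSq m` over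
`{‖∇u‖² ≤ L}` (spectral Chebyshev: `tail ≤ |Au|²/(4π²(m²+1)) ≤ (1+L)^p w/(4π²(m²+1))`, `w = |Au|²/(1+‖∇u‖²)^p`)
and `{‖∇u‖² > L}` (`tail ≤ ‖∇u‖²`, uniformly integrable). [folklore] -/
theorem exists_isResolved_of_uniformlyIntegrable_of_weightedH2
    {𝓕 : Set (Measure (Torus.energySpace (Fin 3)))} {p : ℕ}
    (hUI : UniformlyIntegrableEnstrophy 𝓕) (hH2 : WeightedH2Bound p 𝓕) :
    ∃ κ : ℕ → ℕ, ∀ μ ∈ 𝓕, ∀ n : ℕ,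
      ∫⁻ u, Torus.eGradNormSq (u.1 : UnitAddTorus (Fin 3) → EuclideanSpace ℝ (Fin 3)) ∂μ ≤
        (∫⁻ u, Torus.eGradNormSq (Torus.fourierTruncate (κ n)
          (u.1 : UnitAddTorus (Fin 3) → EuclideanSpace ℝ (Fin 3))) ∂μ) + ((n : ENNReal) + 1)⁻¹ := by
  obtain ⟨C, hC, hH2⟩ := hH2
  -- abbreviations
  let eG : Torus.energySpace (Fin 3) → ℝ≥0∞ := fun u =>
    Torus.eGradNormSq ((u.1 : L2T3) : UnitAddTorus (Fin 3) → EuclideanSpace ℝ (Fin 3))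
  let eL : Torus.energySpace (Fin 3) → ℝ≥0∞ := fun u =>
    eLapNormSq ((u.1 : L2T3) : UnitAddTorus (Fin 3) → EuclideanSpace ℝ (Fin 3))
  let tl : ℕ → Torus.energySpace (Fin 3) → ℝ≥0∞ := fun m u =>
    Torus.tailGradNormSq m ((u.1 : L2T3) : UnitAddTorus (Fin 3) → EuclideanSpace ℝ (Fin 3))
  have heG : Measurable eG := Torus.measurable_eGradNormSq_coe
  have heL : Measurable eL := measurable_eLapNormSq_coe
  have htl : ∀ m, Measurable (tl m) := measurable_tailGradNormSq_coe
  -- for each n, one level m with small mean tail over the whole family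
  have key : ∀ n : ℕ, ∃ m : ℕ, ∀ μ ∈ 𝓕, ∫⁻ u, tl m u ∂μ ≤ ((n : ℝ≥0∞) + 1)⁻¹ := by
    intro n
    set η : ℝ≥0∞ := (2 * ((n : ℝ≥0∞) + 1))⁻¹ with hη
    have h2n : (2 : ℝ≥0∞) * ((n : ℝ≥0∞) + 1) ≠ ⊤ :=
      ENNReal.mul_ne_top (by simp) (by simp)
    have h2n0 : (2 : ℝ≥0∞) * ((n : ℝ≥0∞) + 1) ≠ 0 := mul_ne_zero two_ne_zero (by simp)
    have hη0 : 0 < η := ENNReal.inv_pos.2 h2n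
    have hηtop : η ≠ ⊤ := ENNReal.inv_ne_top.2 h2n0
    obtain ⟨L, hL, hUIL⟩ := hUI η hη0
    set D : ℝ≥0∞ := (1 + L) ^ p * C with hD_def
    have h1L : 1 + L ≠ ⊤ := by simpa using hL
    have hD : D ≠ ⊤ := ENNReal.mul_ne_top (ENNReal.pow_ne_top h1L) hC
    obtain ⟨m, hm⟩ := ENNReal.exists_nat_gt (ENNReal.div_lt_top hD hη0.ne').ne
    refine ⟨m, fun μ hμ => ?_⟩
    set X : ℝ≥0∞ := ENNReal.ofReal (4 * Real.pi ^ 2 * ((m : ℝ) ^ 2 + 1)) with hX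
    have hX0 : X ≠ 0 := (ENNReal.ofReal_pos.2 (by positivity)).ne'
    have hXtop : X ≠ ⊤ := ENNReal.ofReal_ne_top
    have hmX : (m : ℝ≥0∞) ≤ X := by
      rw [hX, ← ENNReal.ofReal_natCast]
      apply ENNReal.ofReal_le_ofReal
      have hpi : 3 < Real.pi := Real.pi_gt_three
      have h1 : (m : ℝ) ≤ (m : ℝ) ^ 2 + 1 := by nlinarith [sq_nonneg ((m : ℝ) - 1)]
      have h2 : (1 : ℝ) ≤ 4 * Real.pi ^ 2 := by nlinarith
      have h3 : (0 : ℝ) ≤ (m : ℝ) ^ 2 + 1 := by positivity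
      nlinarith
    have hDX : D ≤ η * X := by
      have h : D / η < X := hm.trans_le hmX
      rw [ENNReal.div_lt_iff (Or.inl hη0.ne') (Or.inl hηtop)] at h
      rw [mul_comm]
      exact h.le
    -- the event of large enstrophy and the weighted H² density
    set S : Set (Torus.energySpace (Fin 3)) := {u | L < eG u} with hS_def
    have hS : MeasurableSet S := measurableSet_lt measurable_const heG
    let w : Torus.energySpace (Fin 3) → ℝ≥0∞ := fun u => eL u / (1 + eG u) ^ p
    have hw : Measurable w := heL.div ((measurable_const.add heG).pow_const p)
    -- pointwise bound on the tail
    have hpt : ∀ u, tl m u ≤ ((1 + L) ^ p / X) * w u + S.indicator eG u := by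
      intro u
      by_cases hu : L < eG u
      · rw [Set.indicator_of_mem (show u ∈ S from hu)]
        exact (Torus.tailGradNormSq_le m _).trans le_add_self
      · rw [Set.indicator_of_notMem (show u ∉ S from hu), add_zero]
        push Not at hu
        have htopu : eG u ≠ ⊤ := ne_top_of_le_ne_top hL hu
        have hb0 : (1 + eG u) ^ p ≠ 0 := pow_ne_zero _ (by simp)
        have hbtop : (1 + eG u) ^ p ≠ ⊤ := ENNReal.pow_ne_top (by simpa using htopu)
        have h1 : tl m u ≤ eL u / X := by
          rw [ENNReal.le_div_iff_mul_le (Or.inl hX0) (Or.inl hXtop)]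
          exact tailGradNormSq_mul_le_eLapNormSq m _
        have h2 : eL u = w u * (1 + eG u) ^ p := (ENNReal.div_mul_cancel hb0 hbtop).symm
        have h3 : eL u ≤ w u * (1 + L) ^ p := by
          rw [h2]
          gcongr
        calc tl m u ≤ eL u / X := h1
          _ ≤ (w u * (1 + L) ^ p) / X := by gcongr
          _ = ((1 + L) ^ p / X) * w u := by
              rw [div_eq_mul_inv, div_eq_mul_inv]
              ring
    -- integrate
    calc ∫⁻ u, tl m u ∂μ ≤ ∫⁻ u, ((1 + L) ^ p / X) * w u + S.indicator eG u ∂μ := lintegral_mono hpt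
      _ = ((1 + L) ^ p / X) * ∫⁻ u, w u ∂μ + ∫⁻ u in S, eG u ∂μ := by
          rw [lintegral_add_left (hw.const_mul _), lintegral_const_mul _ hw, lintegral_indicator hS]
      _ ≤ ((1 + L) ^ p / X) * C + η := by
          gcongr
          exacts [hH2 μ hμ, hUIL μ hμ]
      _ ≤ η + η := by
          gcongr
          calc (1 + L) ^ p / X * C = D / X := by
                rw [hD_def, div_eq_mul_inv, div_eq_mul_inv]
                ring
            _ ≤ η := by
                rw [ENNReal.div_le_iff_le_mul (Or.inl hX0) (Or.inl hXtop)]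
                exact hDX
      _ = ((n : ℝ≥0∞) + 1)⁻¹ := by
          rw [← two_mul, hη, ENNReal.mul_inv (Or.inl two_ne_zero) (Or.inl ENNReal.ofNat_ne_top),
            ← mul_assoc, ENNReal.mul_inv_cancel two_ne_zero ENNReal.ofNat_ne_top, one_mul]
  choose κ hκ using key
  refine ⟨κ, fun μ hμ n => ?_⟩
  have hsplit : ∀ u : Torus.energySpace (Fin 3), eG u =
      Torus.eGradNormSq (Torus.fourierTruncate (κ n)
        ((u.1 : L2T3) : UnitAddTorus (Fin 3) → EuclideanSpace ℝ (Fin 3))) + tl (κ n) u := fun u =>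
    eGradNormSq_eq_fourierTruncate_add_tail ((Lp.memLp (u.1 : L2T3)).integrable one_le_two) _
  calc ∫⁻ u, eG u ∂μ
      = ∫⁻ u, Torus.eGradNormSq (Torus.fourierTruncate (κ n)
          ((u.1 : L2T3) : UnitAddTorus (Fin 3) → EuclideanSpace ℝ (Fin 3))) + tl (κ n) u ∂μ :=
        lintegral_congr hsplit
    _ = (∫⁻ u, Torus.eGradNormSq (Torus.fourierTruncate (κ n)
          ((u.1 : L2T3) : UnitAddTorus (Fin 3) → EuclideanSpace ℝ (Fin 3))) ∂μ) + ∫⁻ u, tl (κ n) u ∂μ :=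
        lintegral_add_right _ (htl _)
    _ ≤ _ := by
        gcongr
        exact hκ n μ hμ

end Criterion

end

end Summit.AnomalousDissipation.AnomalousDissipation.Theorems.UniformResolution.Negative
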